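import Literature.NumberTheory.EllipticCurves.SzpiroFreyCurveProofs
import Literature.NumberTheory.EllipticCurves.QuadraticTwistTateFormTwoProofs
import Literature.NumberTheory.DiophantineGeometry.TateAlgorithmEvalProofs
import HarnessLib

/-!
# The Frey curve at `2` when `4 ∣ B`, `16 ∤ B`: Tate's algorithm gives `f₂ = 3` (proofs)

Topic `Literature/NumberTheory/DiophantineGeometry`; third sibling *proofs* file (theorems only: no
definition, no named fact, no `sorry`) of `GeneralizedFermatTwoPowerCoefficient` (named fact
`ribet1997_twoPowerFermat`: K. Ribet, Acta Arith. 79 (1997), Thm. 3).  Ribet, §2, pp. 10–11: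
*"the conductor `N_E` of `E` has the form `2^t rad′(ABC)` … The precise value of `t` is computed
by Diamond and Kramer, who find that `t` is `5, 3, 3, 0` or `1` according as `ord₂ (B)` is
`1, 2, 3, 4`, or an integer greater than `4`."*  The sibling `…FreyProofs` treats `ord₂ (B) ≥ 4`
(`t ∈ {0, 1}`, semistable); this file **computes `t = 3` for `ord₂ (B) ∈ {2, 3}`** by running the
tree's Tate algorithm (`DiophantineGeometry/TateAlgorithm*`, Silverman *ATAEC* IV.9.4) on the
Frey curve `y² = x (x − A) (x + B)`, `A ≡ −1 (mod 4)`, over `ℤ₂`: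

* `kodairaSymbolAt_freyCurve_two_of_four_dvd` — `4 ∥ B`: type `I₁*`, `ord₂ Δ_min = 8`, `f₂ = 3`
  (step-6 model `y ↦ y + x`: `(2, B − A − 1, 0, −AB, 0)`, cubic `T³ + ūT`; round `0` of the
  `Iₙ*` sub-procedure on `x ↦ x + 2`, separable quadratic `Y² + Y + ⋯`);
* `kodairaSymbolAt_freyCurve_two_of_eight_dvd` — `8 ∥ B`: type `III*`, `ord₂ Δ_min = 10`,
  `f₂ = 3` (the same model is step-9 normalised with `π⁴ ∤ a₄ = −AB`);
* `conductorExponent_freyCurve_two_eq_three`, and `conductorExponent_freyCurve_two_le_three` in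
  the exact shape of the hypothesis `hDK` of
  `ribet1997_twoPowerFermat_of_khare_wintenberger_of_frey_local` (sibling `…SerreProofs`), which
  is thereby discharged.

Tools: the forward-evaluation theorems `kodairaSymbolOfMinimal_eq_IIIstar_of_step9`
(`TateAlgorithmEvalProofs`), `kodairaSymbolOfMinimal_eq_Istar_of_models`,
`istarIndexAux_succ_of_testA`, `kodairaSymbolAt_eq_kodairaSymbolOfMinimal_of_isMinimal`,
`ordMinimalDiscriminant_eq_of_isMinimal` (`TateAlgorithmIstarEvalProofs`), the characteristic-`2`
tests (`TateAlgorithmIstarCharTwoProofs`), minimality `ord₂ Δ < 12` (`SzpiroLocalDataProofs`), and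
the `2`-adic bookkeeping of integers in `O_v` (`exists_isUnit_eq_uniformizer_pow_mul_of_valued_eq`,
`QuadraticTwistTateFormTwoProofs`).  The values agree with PARI's `elllocalred` on all sampled
`(A, B)` (this seat's check).

## References

* [Ribet1997] K. A. Ribet, *On the equation `a^p + 2^α b^p + c^p = 0`*, Acta Arith. 79 (1997),
  §2, pp. 10–11.
* [DiamondKramer1995] F. Diamond, K. Kramer, *Modularity of a family of elliptic curves*, Math.
  Res. Lett. 2 (1995), 299–304.
* [SilvermanATAEC1994] J. H. Silverman, *Advanced Topics in the Arithmetic of Elliptic Curves*,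
  GTM 151, IV.9.4 (Tate's algorithm), Table 4.1, IV.11.1 (Ogg's formula).
* [SilvermanAEC2009] J. H. Silverman, *The Arithmetic of Elliptic Curves*, 2nd ed., VII.1
  Remark 1.1.
-/

noncomputable section

open IsDedekindDomain WeierstrassCurve Rat.HeightOneSpectrum IsLocalRing Polynomial
open IsDiscreteValuationRing hiding maximalIdeal
open Literature.NumberTheory.DiophantineGeometry.TateAlgorithm Literature.NumberTheory.EllipticCurves

namespace Literature.NumberTheory.DiophantineGeometry

/-! ### `2`-adic bookkeeping at a place `v ∣ 2` of `ℤ` -/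

section TwoAdic

variable (v : HeightOneSpectrum ℤ)

/-- `|2|_v = exp(-1)` at the place `v` of `ℤ` above `2`. [folklore] -/
theorem valuation_two_of_natGenerator_eq_two (hv : natGenerator v = 2) :
    v.valuation ℚ (2 : ℚ) = WithZero.exp (-1 : ℤ) := by
  have h := v.intValuation_singleton (r := (2 : ℤ)) (by norm_num)
    (by rw [asIdeal_eq_span_natGenerator v, hv]; rfl)
  rw [show (2 : ℚ) = algebraMap ℤ ℚ 2 by norm_num, HeightOneSpectrum.valuation_of_algebraMap]
  exact h

/-- `|2ᵏ m|_v = exp(-k)` for `m` odd, at `v ∣ 2`. [folklore] -/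
private theorem valuation_intCast_of_eq_two_pow_mul (hv : natGenerator v = 2) {n m : ℤ} {k : ℕ}
    (hn : n = 2 ^ k * m) (hm : ¬ (2 : ℤ) ∣ m) :
    v.valuation ℚ (n : ℚ) = WithZero.exp (-(k : ℤ)) := by
  have hvm : v.valuation ℚ (m : ℚ) = 1 :=
    (Rat.valuation_intCast_eq_one_iff v m).mpr (by rw [hv]; exact_mod_cast hm)
  rw [hn]
  push_cast
  rw [map_mul, map_pow, valuation_two_of_natGenerator_eq_two v hv, hvm, mul_one,
    ← WithZero.exp_nsmul]
  simp

/-- An integer `n = 2ᵏ m`, `m` odd, is `ϖᵏ · unit` in `ℤ₂ = O_v`. [folklore] -/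
theorem exists_isUnit_intCast_eq_uniformizer_pow_mul (hv : natGenerator v = 2) {n m : ℤ} {k : ℕ}
    (hn : n = 2 ^ k * m) (hm : ¬ (2 : ℤ) ∣ m) :
    ∃ u : v.adicCompletionIntegers ℚ, IsUnit u ∧
      (n : v.adicCompletionIntegers ℚ) = uniformizer (v.adicCompletionIntegers ℚ) ^ k * u := by
  refine WeierstrassCurve.exists_isUnit_eq_uniformizer_pow_mul_of_valued_eq v ?_
  rw [show ((n : v.adicCompletionIntegers ℚ) : v.adicCompletion ℚ) =
      algebraMap ℚ (v.adicCompletion ℚ) (n : ℚ) by simp, valued_algebraMap_adicCompletion,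
    valuation_intCast_of_eq_two_pow_mul v hv hn hm]

/-- `ord_v (2ᵏ m) = k` in `O_v` for `m` odd. [folklore] -/
theorem addVal_intCast_toNat (hv : natGenerator v = 2) {n m : ℤ} {k : ℕ}
    (hn : n = 2 ^ k * m) (hm : ¬ (2 : ℤ) ∣ m) :
    (addVal (v.adicCompletionIntegers ℚ) (n : v.adicCompletionIntegers ℚ)).toNat = k := by
  refine WeierstrassCurve.addVal_toNat_eq_of_valued_eq v ?_
  rw [show ((n : v.adicCompletionIntegers ℚ) : v.adicCompletion ℚ) =
      algebraMap ℚ (v.adicCompletion ℚ) (n : ℚ) by simp, valued_algebraMap_adicCompletion,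
    valuation_intCast_of_eq_two_pow_mul v hv hn hm]

/-- `2 = ϖ ε` with `ε` a unit of `O_v`, `v ∣ 2`. [folklore] -/
private theorem exists_isUnit_two_eq_uniformizer_mul_int (hv : natGenerator v = 2) :
    ∃ ε : v.adicCompletionIntegers ℚ, IsUnit ε ∧
      (2 : v.adicCompletionIntegers ℚ) = uniformizer (v.adicCompletionIntegers ℚ) * ε := by
  obtain ⟨u, hu, h⟩ := exists_isUnit_intCast_eq_uniformizer_pow_mul v hv (n := 2) (m := 1) (k := 1)
    (by norm_num) (by norm_num)
  refine ⟨u, hu, ?_⟩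
  rw [pow_one] at h
  exact_mod_cast h

/-- If `2ᵏ ∣ n` in `ℤ` then `ϖᵏ ∣ n` in `O_v`. [folklore] -/
theorem uniformizer_pow_dvd_intCast (hv : natGenerator v = 2) {n : ℤ} {k : ℕ}
    (h : (2 : ℤ) ^ k ∣ n) :
    uniformizer (v.adicCompletionIntegers ℚ) ^ k ∣ (n : v.adicCompletionIntegers ℚ) := by
  obtain ⟨ε, -, h2⟩ := exists_isUnit_two_eq_uniformizer_mul_int v hv
  obtain ⟨m, rfl⟩ := h
  push_cast
  rw [h2, mul_pow, mul_assoc]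
  exact dvd_mul_right _ _

/-- If `n = 2ᵏ m` with `m` odd then `ϖᵏ⁺¹ ∤ n` in `O_v`. [folklore] -/
theorem not_uniformizer_pow_succ_dvd_intCast (hv : natGenerator v = 2) {n m : ℤ} {k : ℕ}
    (hn : n = 2 ^ k * m) (hm : ¬ (2 : ℤ) ∣ m) :
    ¬ uniformizer (v.adicCompletionIntegers ℚ) ^ (k + 1) ∣ (n : v.adicCompletionIntegers ℚ) := by
  obtain ⟨u, hu, h⟩ := exists_isUnit_intCast_eq_uniformizer_pow_mul v hv hn hm
  rw [h]
  intro hd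
  rw [pow_succ, mul_dvd_mul_iff_left (pow_ne_zero k irreducible_uniformizer.ne_zero)] at hd
  exact irreducible_uniformizer.not_isUnit (isUnit_of_dvd_unit hd hu)

/-- In `O_v`, `v ∣ 2`: `2 = 0` in the residue field. [folklore] -/
theorem residue_two_eq_zero_int (hv : natGenerator v = 2) :
    (2 : ResidueField (v.adicCompletionIntegers ℚ)) = 0 := by
  obtain ⟨ε, -, h2⟩ := exists_isUnit_two_eq_uniformizer_mul_int v hv
  exact residue_two_eq_zero h2

end TwoAdic

/-! ### The two auxiliary integral models of the Frey curve -/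

section Models

variable (A B : ℤ)

/-- The step-6 model `(y ↦ y + x)`: `⟨1, 0, 1, 0⟩ • (y² = x³ + (B − A) x² − AB x)` has
coefficients `(2, B − A − 1, 0, −AB, 0)` and the same discriminant. [folklore] -/
theorem freyModel₆_eq :
    (⟨1, 0, 1, 0⟩ : VariableChange ℤ) • freyIntModel A B = ⟨2, B - A - 1, 0, -(A * B), 0⟩ := by
  have hu : (⟨1, 0, 1, 0⟩ : VariableChange ℤ).u = 1 := rfl
  ext
  · rw [smul_a₁_of_u_eq_one hu]; simp [freyIntModel]
  · rw [smul_a₂_of_u_eq_one hu]; simp [freyIntModel]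
  · rw [smul_a₃_of_u_eq_one hu]; simp [freyIntModel]
  · rw [smul_a₄_of_u_eq_one hu]; simp [freyIntModel]
  · rw [smul_a₆_of_u_eq_one hu]; simp [freyIntModel]

/-- The round-`0` model of the `Iₙ*` sub-procedure (`x ↦ x + 2` on the step-6 model):
coefficients `(2, B − A + 5, 4, −AB + 4 (B − A − 1) + 12, −2AB + 4 (B − A − 1) + 8)`.
[folklore] -/
theorem freyModel₇_eq :
    (⟨1, 2, 0, 0⟩ : VariableChange ℤ) • (⟨2, B - A - 1, 0, -(A * B), 0⟩ : WeierstrassCurve ℤ) =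
      ⟨2, B - A + 5, 4, -(A * B) + 4 * (B - A - 1) + 12, -(2 * A * B) + 4 * (B - A - 1) + 8⟩ := by
  have hu : (⟨1, 2, 0, 0⟩ : VariableChange ℤ).u = 1 := rfl
  ext
  · rw [smul_a₁_of_u_eq_one hu]; simp
  · rw [smul_a₂_of_u_eq_one hu]; simp; ring
  · rw [smul_a₃_of_u_eq_one hu]; simp
  · rw [smul_a₄_of_u_eq_one hu]; simp
  · rw [smul_a₆_of_u_eq_one hu]; simp; ring

end Models


/-! ### The Frey curve over `ℚ₂`: the integral model, `ord Δ`, minimality -/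

section Local

variable {A B : ℤ} (v : HeightOneSpectrum ℤ)

/-- Over `ℚ_v` the Frey curve is the base change of the `O_v`-model obtained from the integral
equation `y² = x³ + (B − A) x² − AB x` (B–G (12.17)). [folklore] -/
theorem baseChange_freyCurve_eq_baseChange_map :
    (freyCurve A B).baseChange (v.adicCompletion ℚ) =
      ((freyIntModel A B).map (algebraMap ℤ (v.adicCompletionIntegers ℚ))).baseChange
        (v.adicCompletion ℚ) := by
  rw [← baseChange_freyIntModel]
  simp only [baseChange, WeierstrassCurve.map_map]
  congr 1

/-- Mathlib's chosen integral model of the Frey curve over `ℚ_v` is the `O_v`-model of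
`y² = x³ + (B − A) x² − AB x` (uniqueness of the integral structure, `O_v → ℚ_v` injective).
[folklore] -/
theorem integralModel_baseChange_freyCurve
    [hI : ((freyCurve A B).baseChange (v.adicCompletion ℚ)).IsIntegral (v.adicCompletionIntegers ℚ)] :
    ((freyCurve A B).baseChange (v.adicCompletion ℚ)).integralModel (v.adicCompletionIntegers ℚ) =
      (freyIntModel A B).map (algebraMap ℤ (v.adicCompletionIntegers ℚ)) := by
  apply WeierstrassCurve.map_injective
    (IsFractionRing.injective (v.adicCompletionIntegers ℚ) (v.adicCompletion ℚ))
  have h1 := baseChange_integralModel_eq (v.adicCompletionIntegers ℚ)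
    ((freyCurve A B).baseChange (v.adicCompletion ℚ))
  change (((freyCurve A B).baseChange (v.adicCompletion ℚ)).integralModel
      (v.adicCompletionIntegers ℚ)).baseChange (v.adicCompletion ℚ) =
    ((freyIntModel A B).map (algebraMap ℤ (v.adicCompletionIntegers ℚ))).baseChange
      (v.adicCompletion ℚ)
  rw [h1, baseChange_freyCurve_eq_baseChange_map]

/-- The Frey curve is `v`-integral (it has the integral equation `y² = x³ + (B − A) x² − AB x`).
[folklore] -/
theorem isIntegral_baseChange_freyCurve :
    ((freyCurve A B).baseChange (v.adicCompletion ℚ)).IsIntegral (v.adicCompletionIntegers ℚ) := by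
  have h := isIntegralAt_baseChange_int v (freyIntModel A B)
  rwa [baseChange_freyIntModel] at h

/-- **`ord₂ Δ = 2j + 4`** for `y² = x³ + (B − A) x² − AB x` over `ℤ₂` when `A`, `A + B` are odd
and `B = 2ʲ b` with `b` odd (`Δ = 16 (AB(A+B))²`). [folklore] -/
theorem addVal_Δ_freyIntModel_map_toNat (hv : natGenerator v = 2) {j : ℕ} {b : ℤ}
    (hB : B = 2 ^ j * b) (hb : ¬ (2 : ℤ) ∣ b) (hA : ¬ (2 : ℤ) ∣ A) (hAB : ¬ (2 : ℤ) ∣ A + B) :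
    (addVal (v.adicCompletionIntegers ℚ)
      ((freyIntModel A B).map (algebraMap ℤ (v.adicCompletionIntegers ℚ))).Δ).toNat = 2 * j + 4 := by
  rw [map_Δ, freyIntModel_Δ, eq_intCast]
  refine addVal_intCast_toNat v hv (m := (A * b * (A + B)) ^ 2) ?_ ?_
  · rw [hB]; ring
  · have hodd : Odd ((A * b * (A + B)) ^ 2) := by
      refine Odd.pow (Int.odd_mul.mpr ⟨Int.odd_mul.mpr ⟨?_, ?_⟩, ?_⟩)
      · exact Int.odd_iff.mpr (Int.two_dvd_ne_zero.mp hA)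
      · exact Int.odd_iff.mpr (Int.two_dvd_ne_zero.mp hb)
      · exact Int.odd_iff.mpr (Int.two_dvd_ne_zero.mp hAB)
    exact Int.two_dvd_ne_zero.mpr (Int.odd_iff.mp hodd)

/-- **Minimality at `2`** of `y² = x³ + (B − A) x² − AB x` for `A`, `A + B` odd, `B = 2ʲ b`,
`b` odd, `j ≤ 3`: `ord₂ Δ = 2j + 4 < 12`. [cite: SilvermanAEC2009, VII.1 Remark 1.1] -/
theorem isMinimalAt_freyCurve_two (hv : natGenerator v = 2) {j : ℕ} {b : ℤ} (hj : j ≤ 3)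
    (hB : B = 2 ^ j * b) (hb : ¬ (2 : ℤ) ∣ b) (hA : ¬ (2 : ℤ) ∣ A) (hAB : ¬ (2 : ℤ) ∣ A + B) :
    (freyCurve A B).IsMinimalAt v := by
  rw [← baseChange_freyIntModel]
  refine isMinimalAt_baseChange_int_of_not_pow_dvd_Δ ?_
  rw [hv, freyIntModel_Δ]
  intro h
  have hodd : Odd ((A * b * (A + B)) ^ 2) := by
    refine Odd.pow (Int.odd_mul.mpr ⟨Int.odd_mul.mpr ⟨?_, ?_⟩, ?_⟩)
    · exact Int.odd_iff.mpr (Int.two_dvd_ne_zero.mp hA)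
    · exact Int.odd_iff.mpr (Int.two_dvd_ne_zero.mp hb)
    · exact Int.odd_iff.mpr (Int.two_dvd_ne_zero.mp hAB)
  have h2m : ¬ (2 : ℤ) ∣ (A * b * (A + B)) ^ 2 := Int.two_dvd_ne_zero.mpr (Int.odd_iff.mp hodd)
  have hcop : IsCoprime ((2 : ℤ) ^ 12) ((A * b * (A + B)) ^ 2) :=
    ((Int.prime_two.coprime_iff_not_dvd).2 h2m).pow_left
  have h' : (2 : ℤ) ^ 12 ∣ 2 ^ (2 * j + 4) * (A * b * (A + B)) ^ 2 := by
    have : (16 : ℤ) * (A * B * (A + B)) ^ 2 = 2 ^ (2 * j + 4) * (A * b * (A + B)) ^ 2 := by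
      rw [hB]; ring
    rw [← this]; exact_mod_cast h
  have h'' : (2 : ℤ) ^ 12 ∣ 2 ^ (2 * j + 4) := hcop.dvd_of_dvd_mul_right h'
  have h3 : 2 ^ 12 ∣ 2 ^ (2 * j + 4) := by exact_mod_cast h''
  have := (Nat.pow_dvd_pow_iff_le_right one_lt_two).mp h3
  omega

/-- `4 ∣ A + 1` makes `A` odd. [folklore] -/
theorem not_two_dvd_of_four_dvd_add_one (hA : 4 ∣ A + 1) : ¬ (2 : ℤ) ∣ A := by
  obtain ⟨k, hk⟩ := hA
  omega

/-! ### Case `8 ∥ B`: type `III*`, `ord₂ Δ_min = 10`, `f₂ = 3` -/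

/-- **The Frey curve `y² = x (x − A) (x + B)` with `A ≡ −1 (mod 4)`, `8 ∥ B`, at `2`: Kodaira type
`III*`, `ord₂ (Δ_min) = 10`, conductor exponent `f₂ = 10 + 1 − 8 = 3`** (Diamond–Kramer 1995;
Ribet 1997, §2, p. 11: "`t` is … `3` … according as `ord₂ (B)` is … `3`").  Tate's algorithm
(Silverman *ATAEC* IV.9.4): the integral equation is minimal (`ord₂ Δ = 10`); after `y ↦ y + x`
the model `(2, B − A − 1, 0, −AB, 0)` is step-9 normalised (`π ∣ a₁`, `π² ∣ a₂`, `π³ ∣ a₃, a₄`,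
`π⁵ ∣ a₆`) with `π⁴ ∤ a₄ = −AB` (`ord₂ (AB) = 3`), so the algorithm returns `III*`
(`kodairaSymbolOfMinimal_eq_IIIstar_of_step9`). [cite: Ribet1997, §2, p. 11]
[cite: DiamondKramer1995] [cite: SilvermanATAEC1994, IV.9.4 Steps 1–9 and Table 4.1] -/
theorem kodairaSymbolAt_freyCurve_two_of_eight_dvd (hv : natGenerator v = 2)
    (h0 : A * B * (A + B) ≠ 0) (hA : 4 ∣ A + 1) {b : ℤ} (hB : B = 8 * b) (hb : ¬ (2 : ℤ) ∣ b) :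
    (freyCurve A B).kodairaSymbolAt v = .IIIstar ∧ (freyCurve A B).ordMinimalDiscriminant v = 10 ∧
      (freyCurve A B).conductorExponent v = 3 := by
  haveI := isElliptic_freyCurve h0
  haveI hI := isIntegral_baseChange_freyCurve (A := A) (B := B) v
  have hA2 : ¬ (2 : ℤ) ∣ A := not_two_dvd_of_four_dvd_add_one hA
  have hAB : ¬ (2 : ℤ) ∣ A + B := by
    rw [hB]; intro h; apply hA2
    have : A = (A + 8 * b) - 2 * (4 * b) := by ring
    rw [this]; exact dvd_sub h (dvd_mul_right 2 _)
  have hB' : B = 2 ^ 3 * b := by rw [hB]; ring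
  haveI hmin : ((freyCurve A B).baseChange (v.adicCompletion ℚ)).IsMinimal
      (v.adicCompletionIntegers ℚ) :=
    isMinimalAt_freyCurve_two v hv (by norm_num) hB' hb hA2 hAB
  have hΔ : ((freyCurve A B).baseChange (v.adicCompletion ℚ)).Δ ≠ 0 := by
    haveI : ((freyCurve A B).baseChange (v.adicCompletion ℚ)).IsElliptic := by
      rw [WeierstrassCurve.baseChange]; infer_instance
    exact ((freyCurve A B).baseChange (v.adicCompletion ℚ)).isUnit_Δ.ne_zero
  have hrel : (freyCurve A B).baseChange (v.adicCompletion ℚ) =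
      (1 : VariableChange (v.adicCompletion ℚ)) • (freyCurve A B).baseChange (v.adicCompletion ℚ) :=
    (one_smul _ _).symm
  have hIM := integralModel_baseChange_freyCurve (A := A) (B := B) v
  set W₀ := (freyIntModel A B).map (algebraMap ℤ (v.adicCompletionIntegers ℚ)) with hW₀
  -- the step-9 model `y ↦ y + x`
  set C₆ : VariableChange (v.adicCompletionIntegers ℚ) :=
    (⟨1, 0, 1, 0⟩ : VariableChange ℤ).map (algebraMap ℤ (v.adicCompletionIntegers ℚ)) with hC₆
  have hW₆ : C₆ • W₀ = (⟨2, B - A - 1, 0, -(A * B), 0⟩ : WeierstrassCurve ℤ).map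
      (algebraMap ℤ (v.adicCompletionIntegers ℚ)) := by
    rw [hW₀, hC₆, map_variableChange, freyModel₆_eq]
  have hK6 : (C₆ • W₀).kodairaSymbolOfMinimal = .IIIstar := by
    rw [hW₆]
    refine kodairaSymbolOfMinimal_eq_IIIstar_of_step9 ?_ ?_ ?_ ?_ ?_ ?_
    · simp only [map_a₁, eq_intCast]
      simpa using uniformizer_pow_dvd_intCast v hv (k := 1) (n := 2) (by norm_num)
    · simp only [map_a₂, eq_intCast]
      refine uniformizer_pow_dvd_intCast v hv (k := 2) ?_
      obtain ⟨k, hk⟩ := hA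
      exact ⟨2 * b - k, by rw [hB]; linear_combination -hk⟩
    · simp only [map_a₃, eq_intCast, Int.cast_zero]; exact dvd_zero _
    · simp only [map_a₄, eq_intCast]
      exact uniformizer_pow_dvd_intCast v hv (k := 3) ⟨-(A * b), by rw [hB]; ring⟩
    · simp only [map_a₆, eq_intCast, Int.cast_zero]; exact dvd_zero _
    · simp only [map_a₄, eq_intCast]
      refine not_uniformizer_pow_succ_dvd_intCast v hv (k := 3) (m := -(A * b)) (by rw [hB]; ring) ?_
      rw [dvd_neg]
      intro h
      rcases Int.prime_two.dvd_or_dvd h with h | h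
      · exact hA2 h
      · exact hb h
  have hK : (freyCurve A B).kodairaSymbolAt v = .IIIstar := by
    rw [kodairaSymbolAt_eq_kodairaSymbolOfMinimal_of_isMinimal v (freyCurve A B) _ 1 hrel hΔ, hIM,
      ← kodairaSymbolOfMinimal_smul W₀ C₆, hK6]
  have hord : (freyCurve A B).ordMinimalDiscriminant v = 10 := by
    rw [ordMinimalDiscriminant_eq_of_isMinimal v (freyCurve A B) _ 1 hrel hΔ, hIM,
      addVal_Δ_freyIntModel_map_toNat v hv hB' hb hA2 hAB]
  refine ⟨hK, hord, ?_⟩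
  show (freyCurve A B).ordMinimalDiscriminant v + 1 - (freyCurve A B).numComponentsAt v = 3
  rw [numComponentsAt, hK, hord]
  rfl

/-- `b₂ = 4 (B − A)`, `b₆ = 0`, `b₈ = −(AB)²` for `y² = x³ + (B − A) x² − AB x`. [folklore] -/
theorem freyIntModel_b (A B : ℤ) :
    (freyIntModel A B).b₂ = 4 * (B - A) ∧ (freyIntModel A B).b₆ = 0 ∧
      (freyIntModel A B).b₈ = -(A * B) ^ 2 := by
  refine ⟨?_, ?_, ?_⟩
  · simp only [freyIntModel, WeierstrassCurve.b₂]; ring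
  · simp only [freyIntModel, WeierstrassCurve.b₆]; ring
  · simp only [freyIntModel, WeierstrassCurve.b₈]; ring

/-! ### Case `4 ∥ B`: type `I₁*`, `ord₂ Δ_min = 8`, `f₂ = 3` -/

/-- **The Frey curve `y² = x (x − A) (x + B)` with `A ≡ −1 (mod 4)`, `4 ∥ B`, at `2`: Kodaira type
`I₁*`, `ord₂ (Δ_min) = 8`, conductor exponent `f₂ = 8 + 1 − 6 = 3`** (Diamond–Kramer 1995; Ribet
1997, §2, p. 11: "`t` is … `3` … according as `ord₂ (B)` is … `2`").  Tate's algorithm (Silverman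
*ATAEC* IV.9.4): the integral equation `W` is minimal (`ord₂ Δ = 8`) and step-2 normalised with
`π ∣ b₂`, `π² ∣ a₆`, `π³ ∣ b₈, b₆`; `y ↦ y + x` gives the step-6 model
`W₆ = (2, B − A − 1, 0, −AB, 0)` whose cubic is `T³ + ūT` (`u = −AB/4` odd), with the two roots
`0`, `√ū` in characteristic `2`; `x ↦ x + 2` puts the double root at `0`:
`W₇ = (2, B − A + 5, 4, −AB + 4(B − A − 1) + 12, −2AB + 4(B − A − 1) + 8)` is normalised for
round `0` of the `Iₙ*` sub-procedure (`π ∥ a₂`, `π² ∣ a₃`, `π³ ∣ a₄`, `π⁴ ∣ a₆`), and the first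
quadratic `Y² + (a₃/4)Y − a₆/16 = Y² + Y + ⋯` is separable, so `n = 1`
(`kodairaSymbolOfMinimal_eq_Istar_of_models`, `istarIndexAux_succ_of_testA`).
[cite: Ribet1997, §2, p. 11] [cite: DiamondKramer1995]
[cite: SilvermanATAEC1994, IV.9.4 Steps 1–7 and Table 4.1] -/
theorem kodairaSymbolAt_freyCurve_two_of_four_dvd (hv : natGenerator v = 2)
    (h0 : A * B * (A + B) ≠ 0) (hA : 4 ∣ A + 1) {b : ℤ} (hB : B = 4 * b) (hb : ¬ (2 : ℤ) ∣ b) :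
    (freyCurve A B).kodairaSymbolAt v = .Istar 1 ∧ (freyCurve A B).ordMinimalDiscriminant v = 8 ∧
      (freyCurve A B).conductorExponent v = 3 := by
  haveI := isElliptic_freyCurve h0
  haveI hI := isIntegral_baseChange_freyCurve (A := A) (B := B) v
  have hA2 : ¬ (2 : ℤ) ∣ A := not_two_dvd_of_four_dvd_add_one hA
  obtain ⟨k, hk⟩ := hA
  obtain ⟨c, hc⟩ : ∃ c : ℤ, b = 2 * c + 1 := ⟨b / 2, by omega⟩
  have hAk : A = 4 * k - 1 := by linear_combination hk
  have hBc : B = 8 * c + 4 := by rw [hB, hc]; ring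
  have hAB : ¬ (2 : ℤ) ∣ A + B := by
    rw [hAk, hBc]; intro h
    have : (2 : ℤ) ∣ (4 * k - 1 + (8 * c + 4)) - 2 * (2 * k + 4 * c + 1) := dvd_sub h (dvd_mul_right 2 _)
    have h1 : (4 * k - 1 + (8 * c + 4)) - 2 * (2 * k + 4 * c + 1) = (1 : ℤ) := by ring
    rw [h1] at this
    exact absurd this (by norm_num)
  have hB' : B = 2 ^ 2 * b := by rw [hB]; ring
  haveI hmin : ((freyCurve A B).baseChange (v.adicCompletion ℚ)).IsMinimal
      (v.adicCompletionIntegers ℚ) :=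
    isMinimalAt_freyCurve_two v hv (by norm_num) hB' hb hA2 hAB
  have hΔ : ((freyCurve A B).baseChange (v.adicCompletion ℚ)).Δ ≠ 0 := by
    haveI : ((freyCurve A B).baseChange (v.adicCompletion ℚ)).IsElliptic := by
      rw [WeierstrassCurve.baseChange]; infer_instance
    exact ((freyCurve A B).baseChange (v.adicCompletion ℚ)).isUnit_Δ.ne_zero
  have hrel : (freyCurve A B).baseChange (v.adicCompletion ℚ) =
      (1 : VariableChange (v.adicCompletion ℚ)) • (freyCurve A B).baseChange (v.adicCompletion ℚ) :=
    (one_smul _ _).symm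
  have hIM := integralModel_baseChange_freyCurve (A := A) (B := B) v
  have h2 := residue_two_eq_zero_int v hv
  set φ := algebraMap ℤ (v.adicCompletionIntegers ℚ) with hφ
  set W₀ := (freyIntModel A B).map φ with hW₀
  set W₆ := (⟨2, B - A - 1, 0, -(A * B), 0⟩ : WeierstrassCurve ℤ).map φ with hW₆def
  set W₇ := (⟨2, B - A + 5, 4, -(A * B) + 4 * (B - A - 1) + 12, -(2 * A * B) + 4 * (B - A - 1) + 8⟩ :
    WeierstrassCurve ℤ).map φ with hW₇def
  set C₆ : VariableChange (v.adicCompletionIntegers ℚ) := (⟨1, 0, 1, 0⟩ : VariableChange ℤ).map φ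
    with hC₆
  set C₇ : VariableChange (v.adicCompletionIntegers ℚ) := (⟨1, 2, 0, 0⟩ : VariableChange ℤ).map φ
    with hC₇
  have hW₆ : W₆ = C₆ • W₀ := by
    rw [hW₀, hC₆, map_variableChange, freyModel₆_eq]
  have hW₇ : W₇ = C₇ • W₆ := by
    rw [hW₆def, hC₇, map_variableChange, freyModel₇_eq]
  -- `ord₂ Δ(W₀) = 8`
  have hordΔ : (addVal (v.adicCompletionIntegers ℚ) W₀.Δ).toNat = 8 :=
    addVal_Δ_freyIntModel_map_toNat v hv hB' hb hA2 hAB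
  -- the evaluation: type `Iₙ*` with `n` computed by the sub-procedure on `W₇`
  have hK0 : W₀.kodairaSymbolOfMinimal =
      .Istar (istarIndexAux (addVal (v.adicCompletionIntegers ℚ) W₀.Δ).toNat 0 W₇) := by
    refine kodairaSymbolOfMinimal_eq_Istar_of_models (W₂ := W₀) (C₂ := 1) ?_ (one_smul _ _).symm
      ?_ ?_ ?_ ?_ ?_ ?_ ?_ hW₆ ?_ ?_ ?_ ?_ ?_ ?_ hW₇ ?_ ?_ ?_ ?_ ?_ ?_
    · -- `ϖ ∣ Δ = 16 (AB(A+B))²`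
      rw [hW₀, map_Δ, freyIntModel_Δ, hφ, eq_intCast]
      simpa only [pow_one] using uniformizer_pow_dvd_intCast v hv (k := 1)
        (n := 16 * (A * B * (A + B)) ^ 2) ⟨8 * (A * B * (A + B)) ^ 2, by ring⟩
    · simp only [hW₀, freyIntModel, map_a₃, hφ, eq_intCast, Int.cast_zero]; exact dvd_zero _
    · simp only [hW₀, freyIntModel, map_a₄, hφ, eq_intCast]
      simpa using uniformizer_pow_dvd_intCast v hv (k := 1) (n := -(A * B)) ⟨-(2 * A * b), by rw [hB]; ring⟩
    · simp only [hW₀, freyIntModel, map_a₆, hφ, eq_intCast, Int.cast_zero]; exact dvd_zero _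
    · rw [hW₀, map_b₂, (freyIntModel_b A B).1, hφ, eq_intCast]
      simpa using uniformizer_pow_dvd_intCast v hv (k := 1) (n := 4 * (B - A)) ⟨2 * (B - A), by ring⟩
    · simp only [hW₀, freyIntModel, map_a₆, hφ, eq_intCast, Int.cast_zero]; exact dvd_zero _
    · rw [hW₀, map_b₈, (freyIntModel_b A B).2.2, hφ, eq_intCast]
      exact uniformizer_pow_dvd_intCast v hv (k := 3) ⟨-(2 * A ^ 2 * b ^ 2), by rw [hB]; ring⟩
    · rw [hW₀, map_b₆, (freyIntModel_b A B).2.1, hφ, eq_intCast, Int.cast_zero]; exact dvd_zero _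
    · simp only [hW₆def, map_a₁, hφ, eq_intCast]
      simpa using uniformizer_pow_dvd_intCast v hv (k := 1) (n := 2) (by norm_num)
    · simp only [hW₆def, map_a₂, hφ, eq_intCast]
      simpa using uniformizer_pow_dvd_intCast v hv (k := 1) (n := B - A - 1)
        ⟨4 * c + 2 - 2 * k, by rw [hAk, hBc]; ring⟩
    · simp only [hW₆def, map_a₃, hφ, eq_intCast, Int.cast_zero]; exact dvd_zero _
    · simp only [hW₆def, map_a₄, hφ, eq_intCast]
      exact uniformizer_pow_dvd_intCast v hv (k := 2) ⟨-(A * b), by rw [hB]; ring⟩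
    · simp only [hW₆def, map_a₆, hφ, eq_intCast, Int.cast_zero]; exact dvd_zero _
    · -- the step-6 cubic `T³ + ū T`, `u = -AB/4` a unit: two distinct roots in characteristic `2`
      have hp : redCoeff W₆.a₂ 1 = 0 := by
        refine redCoeff_eq_zero_of_dvd ?_
        simp only [hW₆def, map_a₂, hφ, eq_intCast]
        exact uniformizer_pow_dvd_intCast v hv (k := 2) ⟨2 * c + 1 - k, by rw [hAk, hBc]; ring⟩
      have hr : redCoeff W₆.a₆ 3 = 0 := by
        refine redCoeff_eq_zero_of_dvd ?_
        simp only [hW₆def, map_a₆, hφ, eq_intCast, Int.cast_zero]; exact dvd_zero _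
      have hq : redCoeff W₆.a₄ 2 ≠ 0 := by
        have hdvd : uniformizer (v.adicCompletionIntegers ℚ) ^ 2 ∣ W₆.a₄ := by
          simp only [hW₆def, map_a₄, hφ, eq_intCast]
          exact uniformizer_pow_dvd_intCast v hv (k := 2) ⟨-(A * b), by rw [hB]; ring⟩
        rw [Ne, redCoeff_eq_zero_iff hdvd]
        simp only [hW₆def, map_a₄, hφ, eq_intCast]
        refine not_uniformizer_pow_succ_dvd_intCast v hv (k := 2) (m := -(A * b)) (by rw [hB]; ring) ?_
        rw [dvd_neg]
        intro h
        rcases Int.prime_two.dvd_or_dvd h with h | h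
        · exact hA2 h
        · exact hb h
      set q := redCoeff W₆.a₄ 2 with hqdef
      show distinctRootCount (X ^ 3 + C (redCoeff W₆.a₂ 1) * X ^ 2 + C (redCoeff W₆.a₄ 2) * X +
        C (redCoeff W₆.a₆ 3)) = 2
      rw [hp, hr, ← hqdef]
      have h4 : (4 : ResidueField (v.adicCompletionIntegers ℚ)) = 0 := by
        rw [show (4 : ResidueField (v.adicCompletionIntegers ℚ)) = 2 * 2 by norm_num, h2, mul_zero]
      have h3 : (3 : ResidueField (v.adicCompletionIntegers ℚ)) = 1 := by
        rw [show (3 : ResidueField (v.adicCompletionIntegers ℚ)) = 1 + 2 by norm_num, h2, add_zero]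
      refine (distinctRootCount_cubic_eq_two_iff 0 q 0 ?_).mpr ?_
      · rw [h4]; ring
      · rw [h3, one_mul, zero_pow two_ne_zero, zero_sub, neg_ne_zero]; exact hq
    · simp only [hW₇def, map_a₁, hφ, eq_intCast]
      simpa using uniformizer_pow_dvd_intCast v hv (k := 1) (n := 2) (by norm_num)
    · simp only [hW₇def, map_a₂, hφ, eq_intCast]
      simpa using uniformizer_pow_dvd_intCast v hv (k := 1) (n := B - A + 5)
        ⟨4 * c - 2 * k + 5, by rw [hAk, hBc]; ring⟩
    · simp only [hW₇def, map_a₂, hφ, eq_intCast]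
      refine not_uniformizer_pow_succ_dvd_intCast v hv (k := 1) (m := 4 * c - 2 * k + 5)
        (by rw [hAk, hBc]; ring) ?_
      intro h
      have : (2 : ℤ) ∣ (4 * c - 2 * k + 5) - 2 * (2 * c - k + 2) := dvd_sub h (dvd_mul_right 2 _)
      have h1 : (4 * c - 2 * k + 5) - 2 * (2 * c - k + 2) = (1 : ℤ) := by ring
      rw [h1] at this
      exact absurd this (by norm_num)
    · simp only [hW₇def, map_a₃, hφ, eq_intCast]
      simpa using uniformizer_pow_dvd_intCast v hv (k := 2) (n := 4) (by norm_num)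
    · simp only [hW₇def, map_a₄, hφ, eq_intCast]
      exact uniformizer_pow_dvd_intCast v hv (k := 3) ⟨-(4 * k * c) - 4 * k + 5 * c + 4,
        by rw [hAk, hBc]; ring⟩
    · simp only [hW₇def, map_a₆, hφ, eq_intCast]
      exact uniformizer_pow_dvd_intCast v hv (k := 4) ⟨-(4 * k * c) - 3 * k + 3 * c + 2,
        by rw [hAk, hBc]; ring⟩
  -- round `0` of the sub-procedure: the first quadratic `Y² + (a₃/4) Y − a₆/16` is separable
  have hA7 : distinctRootCount (X ^ 2 + C (redCoeff W₇.a₃ (0 + 2)) * X -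
      C (redCoeff W₇.a₆ (2 * 0 + 4))) = 2 := by
    refine (testA_iff_of_two_eq_zero h2 _ _).mpr ?_
    have hdvd : uniformizer (v.adicCompletionIntegers ℚ) ^ 2 ∣ W₇.a₃ := by
      simp only [hW₇def, map_a₃, hφ, eq_intCast]
      simpa using uniformizer_pow_dvd_intCast v hv (k := 2) (n := 4) (by norm_num)
    rw [show (0 + 2 : ℕ) = 2 from rfl, Ne, redCoeff_eq_zero_iff hdvd]
    simp only [hW₇def, map_a₃, hφ, eq_intCast]
    simpa using not_uniformizer_pow_succ_dvd_intCast v hv (k := 2) (n := 4) (m := 1)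
      (by norm_num) (by norm_num)
  have hn : istarIndexAux (addVal (v.adicCompletionIntegers ℚ) W₀.Δ).toNat 0 W₇ = 1 := by
    rw [hordΔ, show (8 : ℕ) = 7 + 1 from rfl, istarIndexAux_succ_of_testA 7 0 W₇ hA7]
  rw [hn] at hK0
  have hK : (freyCurve A B).kodairaSymbolAt v = .Istar 1 := by
    rw [kodairaSymbolAt_eq_kodairaSymbolOfMinimal_of_isMinimal v (freyCurve A B) _ 1 hrel hΔ, hIM,
      hK0]
  have hord : (freyCurve A B).ordMinimalDiscriminant v = 8 := by
    rw [ordMinimalDiscriminant_eq_of_isMinimal v (freyCurve A B) _ 1 hrel hΔ, hIM, hordΔ]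
  refine ⟨hK, hord, ?_⟩
  show (freyCurve A B).ordMinimalDiscriminant v + 1 - (freyCurve A B).numComponentsAt v = 3
  rw [numComponentsAt, hK, hord]
  rfl

/-! ### Summary: `f₂ = 3` for `ord₂ (B) ∈ {2, 3}` -/

/-- **Diamond–Kramer's `t = 3`** (Ribet 1997, §2, pp. 10–11: "the conductor `N_E` of `E` has the
form `2^t rad′(ABC)` … `t` is `5, 3, 3, 0` or `1` according as `ord₂ (B)` is `1, 2, 3, 4`, or an
integer greater than `4`" — the two cases `t = 3`): for `A ≡ −1 (mod 4)`, `4 ∣ B`, `16 ∤ B`,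
`AB(A+B) ≠ 0`, the conductor exponent of the Frey curve `y² = x (x − A) (x + B)` at `2` is `3`
(`kodairaSymbolAt_freyCurve_two_of_four_dvd`: `I₁*`, `8 + 1 − 6`;
`kodairaSymbolAt_freyCurve_two_of_eight_dvd`: `III*`, `10 + 1 − 8`). [cite: Ribet1997, §2, pp. 10–11]
[cite: DiamondKramer1995] -/
theorem conductorExponent_freyCurve_two_eq_three (hv : natGenerator v = 2)
    (h0 : A * B * (A + B) ≠ 0) (hA : A ≡ -1 [ZMOD 4]) (h4 : (4 : ℤ) ∣ B) (h16 : ¬ (16 : ℤ) ∣ B) :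
    (freyCurve A B).conductorExponent v = 3 := by
  have hA' : 4 ∣ A + 1 := by
    have := Int.ModEq.dvd hA.symm
    simpa [sub_neg_eq_add] using this
  obtain ⟨b₀, hb₀⟩ := h4
  by_cases h2 : (2 : ℤ) ∣ b₀
  · obtain ⟨b, hb⟩ := h2
    have hbodd : ¬ (2 : ℤ) ∣ b := fun ⟨e, he⟩ ↦ h16 ⟨e, by rw [hb₀, hb, he]; ring⟩
    exact (kodairaSymbolAt_freyCurve_two_of_eight_dvd v hv h0 hA' (b := b)
      (by rw [hb₀, hb]; ring) hbodd).2.2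
  · exact (kodairaSymbolAt_freyCurve_two_of_four_dvd v hv h0 hA' hb₀ h2).2.2

/-- **`f₂ (freyCurve A B) ≤ 3` for `A ≡ −1 (mod 4)`, `4 ∣ B`, `16 ∤ B`** — exactly the hypothesis
`hDK` of `ribet1997_twoPowerFermat_of_khare_wintenberger_of_frey_local`
(`GeneralizedFermatTwoPowerCoefficientSerreProofs`), at the place
`primesEquiv.symm 2` of `ℤ`; the coprimality hypothesis there is not needed.
[cite: Ribet1997, §2, pp. 10–11] [cite: DiamondKramer1995] -/
theorem conductorExponent_freyCurve_two_le_three :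
    ∀ A B : ℤ, IsCoprime A B → A * B * (A + B) ≠ 0 → A ≡ -1 [ZMOD 4] → (4 : ℤ) ∣ B →
      ¬ (16 : ℤ) ∣ B →
        (freyCurve A B).conductorExponent ((primesEquiv (R := ℤ)).symm ⟨2, Nat.prime_two⟩) ≤ 3 := by
  intro A B _ h0 hA h4 h16
  exact (conductorExponent_freyCurve_two_eq_three _
    (Rat.natGenerator_primesEquiv_symm ⟨2, Nat.prime_two⟩) h0 hA h4 h16).le

end Local

end Literature.NumberTheory.DiophantineGeometry
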